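import Literature.MathematicalPhysics.QuantumFieldTheory.ConformalBootstrap3D.SigmaEpsilonSystem

/-!
# Sanity lemmas for `SigmaEpsilonData.HasConvergentWeights` (pub-ising3d REVIEW-RUNBOOK)

Review evidence only (ops-runbook sanity registry `registry/pub-ising3d.json`); no new definitions.
`D.HasConvergentWeights`: at every `x ∈ (0,1)` the three diagonal OPE sums `∑ λ² g(x,x)` converge
(`Literature/MathematicalPhysics/QuantumFieldTheory/ConformalBootstrap3D/SigmaEpsilonSystem.lean`).

* holds (structural): every datum with FINITE exchanged spectra (`Finite D.ιp`, `Finite D.ιm`) — in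
  particular every truncated spectrum of a numerical certificate — has convergent weights; so does a
  datum all of whose OPE coefficients vanish;
* fails (explicit): the datum with spectrum `ℕ`, unit OPE coefficients `λ_{σσ𝒪ᵢ} = 1` and constant unit
  blocks has the divergent diagonal sum `∑ᵢ 1` — the clause is not vacuous (it is what licenses termwise
  application of derivative functionals, REFEREE F39).
-/

namespace Summit.CriticalPhenomena.Ising3D.Runbook

open Literature.MathematicalPhysics.QuantumFieldTheory.ConformalBootstrap3D

/-- Holds (structural): finite exchanged spectra have convergent weights (finite sums). -/
theorem hasConvergentWeights_of_finite (D : SigmaEpsilonData) [Finite D.ιp] [Finite D.ιm] :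
    D.HasConvergentWeights := by
  intro x _ _
  exact ⟨Summable.of_finite, Summable.of_finite, Summable.of_finite⟩

/-- Holds (degenerate): if all OPE coefficients vanish, the weights converge (all terms are `0`). -/
theorem hasConvergentWeights_of_lam_eq_zero (D : SigmaEpsilonData) (h₁ : D.lamσσ = 0) (h₂ : D.lamεε = 0)
    (h₃ : D.lamσε = 0) : D.HasConvergentWeights := by
  intro x _ _
  simp only [h₁, h₂, h₃, Pi.zero_apply, ne_eq, OfNat.ofNat_ne_zero, not_false_eq_true, zero_pow,
    zero_mul]
  exact ⟨summable_zero, summable_zero, summable_zero⟩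

/-- The explicit divergent datum: spectrum `ℕ` in the even sector, `λ_{σσ𝒪ᵢ} = 1`, constant unit blocks,
empty odd sector data set to `0`. -/
theorem not_hasConvergentWeights_unitWeights :
    ¬ (SigmaEpsilonData.mk 0 0 ℕ 0 0 1 0 (fun _ _ _ => 1) ℕ 0 0 0 (fun _ _ _ => 0)
        (fun _ _ _ => 0)).HasConvergentWeights := by
  intro h
  have h1 := (h (1 / 2) (by norm_num) (by norm_num)).1
  simp only [Pi.one_apply, one_pow, mul_one] at h1
  exact one_ne_zero ((summable_const_iff (1 : ℝ)).mp h1)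

/-- Hence `HasConvergentWeights` is neither trivially true nor trivially false on `SigmaEpsilonData`. -/
theorem hasConvergentWeights_nontrivial :
    (∃ D : SigmaEpsilonData, D.HasConvergentWeights) ∧ ∃ D : SigmaEpsilonData, ¬ D.HasConvergentWeights :=
  ⟨⟨SigmaEpsilonData.mk 0 0 (Fin 1) 0 0 1 0 (fun _ _ _ => 1) (Fin 1) 0 0 0 (fun _ _ _ => 0) (fun _ _ _ => 0),
      hasConvergentWeights_of_finite _⟩,
    ⟨_, not_hasConvergentWeights_unitWeights⟩⟩

end Summit.CriticalPhenomena.Ising3D.Runbook
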